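/-
COR-CM (cell pub-hodgecm2, stage 2 of the Hodge ladder) — count-neutral KERNEL COMBINATORICS «order 16: the quaternion doublings `Q₈ × ℤ/2` and
`Q₈ ∘ ℤ/4` (Pauli)», part I: the LABEL MODEL (seat prover-pub-hodgecm2-b23-g54-0, binder prover b23, gen 54; claim HOME/INBOX.md l.25095).
Bookkeeping definitions with bodies (labels `Fin 8 → ℤ/2`, motions, model faces, the coded cancellation test) + theorems; pure finite
combinatorics, no group, no CM field; `decide` only on closed literal tables of the model (the 256-label code round trip uses `decide +kernel`),
no certificate, no named fact, no `sorry`.  `Interfaces.lean` (C1), every E term, B01, `Transposition/*`, `PortJoin/*`, `D2Bridge/*` untouched.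
HONEST FRAMING: `HC_CM` is NOT proved, here or anywhere in the tree; nothing here is a period, a count of record or a headline.
T5: n/a-class (no hypothesis binders); checker: self.
-/
import Summits.HodgeConjecture.CorCM.Prior.AllgGroup1

/-!
# The quaternion doublings, I: the label model

A QUATERNION DOUBLING is a group `G` of order `16` generated by `i, j, x` with `i² = j² = c`, `i j i = j` (so `H = ⟨i, j⟩ ≅ Q₈` with
central involution `c`), `x² = 1`, `x ∉ H`, and `x i x = cᵗ i`, `x j x = cᵗ j` for a TWIST `t = τ ∈ ℤ/2`: `τ = 0` is `Q₈ × ℤ/2` (`x` central),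
`τ = 1` is the Pauli group `Q₈ ∘ ℤ/4 = D₄ ∘ ℤ/4` (`x` acts as conjugation by `k = ij`; `k·x` is central of order `4` with square `c`).  These
are the last two open rows of order `16` of the face census (seat b09 gen 46 closed `D₄ × ℤ/2`, `G(16,3)`, `ℤ/4 ⋊ ℤ/4`).

THE MODEL (part III is the dictionary).  Every element is uniquely a WORD `cᵉ · r_v`, `r = (1, i, j, ij, x, ix, jx, ijx)` indexed by the
PLACES `v ∈ Fin 8` (`v = a + 2b + 4d` for `iᵃ jᵇ xᵈ`); an abstract CM type `Ψ` is the LABEL `Θ : Fin 8 → ℤ/2` with `Θ v = e ↔ cᵉ r_v ∈ Ψ`.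
* §1 **Motions.**  Right multiplication `r_v · Q = c^{m_Q v} r_{π_Q v}` is a permutation of the places with a cocycle mask; the base change
  `Ψ ↦ Ψ·Q⁻¹` reads `Θ ↦ (v ↦ Θ (π_Q v) + m_Q v)` (`mv`).  Tables: `i ↦ (π = (1 0 3 2 5 4 7 6), m = (0 1 1 0 τ 1+τ 1+τ τ))`,
  `j ↦ ((2 3 0 1 6 7 4 5), (0 0 1 1 τ τ 1+τ 1+τ))`, `x ↦ ((4 5 6 7 0 1 2 3), 0)`, `c ↦ (id, 1)`; the twist enters only the masks on the `x`-coset.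
  The sixteen WORD MOTIONS `Motw τ w`, `w = e + 2a + 4b + 8d ∈ Fin 16`, are `μC^e ∘ μI^a ∘ μJ^b ∘ μX^d`.
* §2 **Flips, faces, pairs** on labels: `flipAt v`, the model face `mface Θ p q = [Θ] + [Θ^{pq}] − [Θ^p] − [Θ^q]` and the model pair
  `[Θ] + [Θ + 1]` in `ℤ[labels] = (Fin 8 → ℤ/2) →₀ ℤ`.
* §3 **The coded cancellation test.**  `code Θ = Σ Θ_v 2^v` is injective; a signed list of labels whose coded coefficients cancel
  label by label evaluates to `0` in `ℤ[labels]` (`evalL_eq_zero_of_cancels`) — the kernel-checkable form of an identity between faces.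
* §4 **Distance and places of the core.**  `H`-places `u ∈ Fin 4` (`hp u = u`) and `x`-coset places (`xp u = u + 4`); the DISTANCE
  `Dst τ Θ = #{u | Θ u ≠ Θ (u+4) + twist τ u}`, `twist τ = (0, τ, τ, 0)` (part III: `=` seat b23 gen 46ʼs `wt (res₁ Ψ) (res₀ Ψ)`).
  All 256 labels: `labOfNat`, the round trip `code (labOfNat k) = k` (whence injectivity of the code) and `forall_lab_iff` (a statement
  about all labels is a statement about `k < 256`).
* §5 **Certificates**: signed face sums (`Src`), translated entries, their expansion into signed label lists, and the evaluation lemmas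
  (`evalL_expandSrc`); part VI feeds them the closing tables.
All [folklore] bookkeeping over [Pohlmann1968, Thm 1].

## References
* [Pohlmann1968] H. Pohlmann, Algebraic cycles on abelian varieties of complex multiplication type, Ann. of Math. 88 (1968), Thm 1.
-/

namespace Summit.HodgeConjecture.CorCM.Census.QuaternionDoubling

open Finset

noncomputable section

/-! ## §1 Labels and motions -/

/-- **Labels**: functions `Fin 8 → ℤ/2` (coordinate `v = a + 2b + 4d` ↔ the place of `iᵃ jᵇ xᵈ`). [folklore] -/
abbrev Lab : Type := Fin 8 → ZMod 2

/-- The motion with place permutation `π` and cocycle mask `m`: `Θ ↦ (v ↦ Θ (π v) + m v)`. [folklore] -/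
def mv (π : Fin 8 → Fin 8) (m : Fin 8 → ZMod 2) (Θ : Lab) : Lab := fun v => Θ (π v) + m v

/-- `mv` evaluated. [folklore] -/
@[simp] theorem mv_apply (π : Fin 8 → Fin 8) (m : Fin 8 → ZMod 2) (Θ : Lab) (v : Fin 8) : mv π m Θ v = Θ (π v) + m v := rfl

/-- Place permutation of right multiplication by `i`. [folklore] -/
def πI : Fin 8 → Fin 8 := ![1, 0, 3, 2, 5, 4, 7, 6]
/-- Cocycle mask of right multiplication by `i` (twist `τ` on the `x`-coset). [folklore] -/
def mI (τ : ZMod 2) : Fin 8 → ZMod 2 := ![0, 1, 1, 0, τ, 1 + τ, 1 + τ, τ]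
/-- Place permutation of right multiplication by `j`. [folklore] -/
def πJ : Fin 8 → Fin 8 := ![2, 3, 0, 1, 6, 7, 4, 5]
/-- Cocycle mask of right multiplication by `j`. [folklore] -/
def mJ (τ : ZMod 2) : Fin 8 → ZMod 2 := ![0, 0, 1, 1, τ, τ, 1 + τ, 1 + τ]
/-- Place permutation of right multiplication by `x` (the two cosets swap, no mask). [folklore] -/
def πX : Fin 8 → Fin 8 := ![4, 5, 6, 7, 0, 1, 2, 3]

/-- **The motion of `i`.** [folklore] -/
def μI (τ : ZMod 2) : Lab → Lab := mv πI (mI τ)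
/-- **The motion of `j`.** [folklore] -/
def μJ (τ : ZMod 2) : Lab → Lab := mv πJ (mJ τ)
/-- **The motion of `x`.** [folklore] -/
def μX : Lab → Lab := mv πX 0
/-- **The motion of `c`** (complement). [folklore] -/
def μC : Lab → Lab := mv id 1

/-- `μI` evaluated. [folklore] -/
@[simp] theorem μI_apply (τ : ZMod 2) (Θ : Lab) (v : Fin 8) : μI τ Θ v = Θ (πI v) + mI τ v := rfl
/-- `μJ` evaluated. [folklore] -/
@[simp] theorem μJ_apply (τ : ZMod 2) (Θ : Lab) (v : Fin 8) : μJ τ Θ v = Θ (πJ v) + mJ τ v := rfl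
/-- `μX` evaluated. [folklore] -/
@[simp] theorem μX_apply (Θ : Lab) (v : Fin 8) : μX Θ v = Θ (πX v) := by simp [μX]
/-- `μC` evaluated. [folklore] -/
@[simp] theorem μC_apply (Θ : Lab) (v : Fin 8) : μC Θ v = Θ v + 1 := rfl

/-- **The word motion** of `w = e + 2a + 4b + 8d`: `μC^e ∘ μI^a ∘ μJ^b ∘ μX^d` (the base change along `cᵉ iᵃ jᵇ xᵈ`). [folklore] -/
def Motw (τ : ZMod 2) (w : Fin 16) (Θ : Lab) : Lab :=
  μC^[w.val % 2] ((μI τ)^[w.val / 2 % 2] ((μJ τ)^[w.val / 4 % 2] (μX^[w.val / 8 % 2] Θ)))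

/-- The trivial word moves nothing. [folklore] -/
@[simp] theorem Motw_zero (τ : ZMod 2) (Θ : Lab) : Motw τ 0 Θ = Θ := rfl

/-! ## §2 Flips, model faces, model pairs -/

/-- **Flip at a place.** [folklore] -/
def flipAt (p : Fin 8) (Θ : Lab) : Lab := Θ + Pi.single p 1

/-- A flip at `p` read at `v`. [folklore] -/
theorem flipAt_apply (p : Fin 8) (Θ : Lab) (v : Fin 8) : flipAt p Θ v = Θ v + if v = p then 1 else 0 := by
  simp [flipAt, Pi.single_apply]

/-- **The model face** `[Θ] + [Θ^{pq}] − [Θ^p] − [Θ^q]`. [folklore] -/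
def mface (Θ : Lab) (p q : Fin 8) : Lab →₀ ℤ :=
  Finsupp.single Θ 1 + Finsupp.single (flipAt p (flipAt q Θ)) 1 - Finsupp.single (flipAt p Θ) 1 - Finsupp.single (flipAt q Θ) 1

/-- **The model pair** `[Θ] + [Θ + 1]`. [folklore] -/
def mpair (Θ : Lab) : Lab →₀ ℤ := Finsupp.single Θ 1 + Finsupp.single (μC Θ) 1

/-! ## §3 Signed label lists and the coded cancellation test -/

/-- Evaluation of a signed list of labels in `ℤ[labels]`. [folklore] -/
def evalL (l : List (Lab × ℤ)) : Lab →₀ ℤ := (l.map fun p => Finsupp.single p.1 p.2).sum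

/-- `evalL [] = 0`. [folklore] -/
@[simp] theorem evalL_nil : evalL [] = 0 := rfl

/-- `evalL` of a cons. [folklore] -/
@[simp] theorem evalL_cons (p : Lab × ℤ) (l : List (Lab × ℤ)) : evalL (p :: l) = Finsupp.single p.1 p.2 + evalL l := rfl

/-- `evalL` is additive in the list. [folklore] -/
@[simp] theorem evalL_append (l l' : List (Lab × ℤ)) : evalL (l ++ l') = evalL l + evalL l' := by
  simp [evalL, List.map_append, List.sum_append]

/-- `evalL` of a `flatMap`. [folklore] -/
theorem evalL_flatMap {α : Type*} (l : List α) (f : α → List (Lab × ℤ)) : evalL (l.flatMap f) = (l.map fun a => evalL (f a)).sum := by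
  induction l with
  | nil => rfl
  | cons a l ih => rw [List.flatMap_cons, evalL_append, ih, List.map_cons, List.sum_cons]

/-- The value of `evalL l` at a label is the sum of the coefficients listed at that label. [folklore] -/
theorem evalL_apply (l : List (Lab × ℤ)) (Θ : Lab) : evalL l Θ = ((l.filter fun p => p.1 = Θ).map Prod.snd).sum := by
  induction l with
  | nil => rfl
  | cons p l ih =>
    rw [evalL_cons, Finsupp.add_apply, ih, List.filter_cons]
    by_cases h : p.1 = Θ
    · simp [h]
    · simp [h]

/-- Mapping the labels of a list maps its evaluation. [folklore] -/
theorem mapDomain_evalL (f : Lab → Lab) (l : List (Lab × ℤ)) :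
    Finsupp.mapDomain f (evalL l) = evalL (l.map fun p => (f p.1, p.2)) := by
  induction l with
  | nil => simp
  | cons p l ih => rw [evalL_cons, Finsupp.mapDomain_add, Finsupp.mapDomain_single, ih, List.map_cons, evalL_cons]

/-- Scaling a list scales its evaluation. [folklore] -/
theorem smul_evalL (n : ℤ) (l : List (Lab × ℤ)) : n • evalL l = evalL (l.map fun p => (p.1, n * p.2)) := by
  induction l with
  | nil => simp
  | cons p l ih => rw [evalL_cons, smul_add, ih, List.map_cons, evalL_cons, Finsupp.smul_single, smul_eq_mul]

/-- **The code** of a label: `Σ_v Θ_v 2^v ∈ [0, 256)`. [folklore] -/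
def code (Θ : Lab) : ℕ := ∑ v : Fin 8, (Θ v).val * 2 ^ (v : ℕ)


/-- The label with a given code. [folklore] -/
def labOfNat (k : ℕ) : Lab := fun v => ((k / 2 ^ (v : ℕ) % 2 : ℕ) : ZMod 2)

/-- **The code round trip** on `[0, 256)`. [folklore] -/
theorem code_labOfNat : ∀ k : Fin 256, code (labOfNat k.val) = k.val := by decide +kernel

/-- The code of a label is `< 256`. [folklore] -/
theorem code_lt (Θ : Lab) : code Θ < 256 := by
  have h : ∀ v : Fin 8, (Θ v).val * 2 ^ (v : ℕ) ≤ 1 * 2 ^ (v : ℕ) := fun v =>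
    Nat.mul_le_mul_right _ (Nat.lt_succ_iff.mp (ZMod.val_lt (Θ v)))
  calc code Θ ≤ ∑ v : Fin 8, 1 * 2 ^ (v : ℕ) := Finset.sum_le_sum fun v _ => h v
    _ < 256 := by decide

/-- `labOfNat` hits every label. [folklore] -/
theorem labOfNat_surjective : ∀ Θ : Lab, ∃ k : Fin 256, labOfNat k.val = Θ := by
  have hinj : Function.Injective fun k : Fin 256 => labOfNat k.val := by
    intro k k' h
    have := congrArg code h
    simp only [code_labOfNat] at this
    exact Fin.ext this
  have hcard : Fintype.card (Fin 256) = Fintype.card Lab := by simp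
  exact (Fintype.bijective_iff_injective_and_card _).mpr ⟨hinj, hcard⟩ |>.2

/-- **The code is injective.** [folklore] -/
theorem code_injective : Function.Injective code := by
  intro Θ Θ' h
  obtain ⟨k, rfl⟩ := labOfNat_surjective Θ
  obtain ⟨k', rfl⟩ := labOfNat_surjective Θ'
  rw [code_labOfNat, code_labOfNat] at h
  rw [h]

/-- A property of all labels is a property of the `256` coded ones. [folklore] -/
theorem forall_lab_iff (P : Lab → Prop) : (∀ Θ, P Θ) ↔ ∀ k : Fin 256, P (labOfNat k.val) :=
  ⟨fun h k => h _, fun h Θ => by obtain ⟨k, rfl⟩ := labOfNat_surjective Θ; exact h k⟩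

/-- **The cancellation test** on coded signed lists: every code carries total coefficient `0`. [folklore] -/
def cancels (l : List (ℕ × ℤ)) : Bool :=
  l.all fun p => ((l.filter fun q => q.1 == p.1).map Prod.snd).sum == 0

/-- **SOUNDNESS OF THE CANCELLATION TEST**: a signed list of labels whose coded coefficients cancel evaluates to `0`. [folklore] -/
theorem evalL_eq_zero_of_cancels (l : List (Lab × ℤ)) (h : cancels (l.map fun p => (code p.1, p.2)) = true) : evalL l = 0 := by
  ext Θ
  rw [evalL_apply, Finsupp.zero_apply]
  by_cases hΘ : ∃ p ∈ l, p.1 = Θ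
  · obtain ⟨p, hp, hpΘ⟩ := hΘ
    rw [cancels, List.all_eq_true] at h
    have h1 := h (code p.1, p.2) (List.mem_map.mpr ⟨p, hp, rfl⟩)
    simp only [beq_iff_eq] at h1
    have key : ((l.map fun p => (code p.1, p.2)).filter fun q => q.1 == code p.1).map Prod.snd =
        (l.filter fun q => q.1 = Θ).map Prod.snd := by
      rw [List.filter_map, List.map_map]
      have hf : (fun q : ℕ × ℤ => q.1 == code p.1) ∘ (fun p : Lab × ℤ => (code p.1, p.2)) = fun q => decide (q.1 = Θ) := by
        funext q
        simp only [Function.comp, ← hpΘ]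
        by_cases hq : q.1 = p.1
        · simp [hq]
        · have : code q.1 ≠ code p.1 := fun e => hq (code_injective e)
          simp [hq, this]
      rw [hf]
      rfl
    rw [key] at h1
    exact_mod_cast h1
  · push Not at hΘ
    rw [List.filter_eq_nil_iff.mpr]
    · rfl
    · intro p hp; simpa using hΘ p hp

/-- The four signed corners of a model face. [folklore] -/
def corners (Θ : Lab) (p q : Fin 8) : List (Lab × ℤ) := [(Θ, 1), (flipAt p (flipAt q Θ), 1), (flipAt p Θ, -1), (flipAt q Θ, -1)]

/-- A model face is the evaluation of its corner list. [folklore] -/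
theorem mface_eq_evalL (Θ : Lab) (p q : Fin 8) : mface Θ p q = evalL (corners Θ p q) := by
  simp only [mface, corners, evalL_cons, evalL_nil, add_zero, Finsupp.single_neg]
  abel

/-- A model pair is the evaluation of `[(Θ, 1), (Θ + 1, 1)]`. [folklore] -/
theorem mpair_eq_evalL (Θ : Lab) : mpair Θ = evalL [(Θ, 1), (μC Θ, 1)] := by
  simp [mpair, evalL]

/-! ## §4 Places of the core and the distance -/

/-- The `H`-place `u ∈ Fin 4` as a place of `G`. [folklore] -/
def hp (u : Fin 4) : Fin 8 := Fin.castLE (by norm_num) u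

/-- The `x`-coset place `u + 4`. [folklore] -/
def xp (u : Fin 4) : Fin 8 := Fin.natAdd 4 u

/-- **The twist** read on the four `H`-places: `(0, τ, τ, 0)` (`x iᵃ jᵇ = c^{τ(a+b)} iᵃ jᵇ x`). [folklore] -/
def twist (τ : ZMod 2) : Fin 4 → ZMod 2 := ![0, τ, τ, 0]

/-- The set of MISMATCHED core places of a label. [folklore] -/
def devSet (τ : ZMod 2) (Θ : Lab) : Finset (Fin 4) := univ.filter fun u => Θ (hp u) ≠ Θ (xp u) + twist τ u

/-- **The distance** of a label: the number of mismatched core places (part III: `= wt (res₁ Ψ) (res₀ Ψ)`). [folklore] -/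
def Dst (τ : ZMod 2) (Θ : Lab) : ℕ := (devSet τ Θ).card

/-! ## §5 Certificates: signed face sums, translated entries, expansions -/

/-- A signed sum of model faces: entries `((Θ, p, q), sign)`. [folklore] -/
abbrev Src : Type := List ((Lab × Fin 8 × Fin 8) × ℤ)

/-- **The model value** of a signed face sum. [folklore] -/
def srcVal (s : Src) : Lab →₀ ℤ := (s.map fun e => e.2 • mface e.1.1 e.1.2.1 e.1.2.2).sum

/-- **Expansion** of `n • (translate by the word w)` of a signed face sum into a signed label list. [folklore] -/
def expandSrc (τ : ZMod 2) (s : Src) (w : Fin 16) (n : ℤ) : List (Lab × ℤ) :=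
  s.flatMap fun e => (corners e.1.1 e.1.2.1 e.1.2.2).map fun p => (Motw τ w p.1, n * (e.2 * p.2))

/-- `srcVal` of a cons. [folklore] -/
theorem srcVal_cons (e : (Lab × Fin 8 × Fin 8) × ℤ) (s : Src) : srcVal (e :: s) = e.2 • mface e.1.1 e.1.2.1 e.1.2.2 + srcVal s := rfl

/-- **The expansion evaluates to the translated, scaled face sum.** [folklore] -/
theorem evalL_expandSrc (τ : ZMod 2) (s : Src) (w : Fin 16) (n : ℤ) :
    evalL (expandSrc τ s w n) = n • Finsupp.mapDomain (Motw τ w) (srcVal s) := by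
  induction s with
  | nil => simp [expandSrc, srcVal]
  | cons e s ih =>
    rw [expandSrc, List.flatMap_cons, evalL_append, ← expandSrc, ih, srcVal_cons, Finsupp.mapDomain_add, smul_add,
      mface_eq_evalL, smul_evalL, mapDomain_evalL, smul_evalL, List.map_map, List.map_map]
    rfl

/-- At the trivial word with coefficient `1` the expansion is the face sum itself. [folklore] -/
theorem evalL_expandSrc_zero (τ : ZMod 2) (s : Src) : evalL (expandSrc τ s 0 1) = srcVal s := by
  rw [evalL_expandSrc, one_smul]
  exact Finsupp.mapDomain_id

/-- Expansion of a list of signed pair coefficients `(Θ, n) ↦ −n·([Θ] + [Θ+1])`. [folklore] -/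
def expandPairs (ps : List (Lab × ℤ)) : List (Lab × ℤ) := ps.flatMap fun p => [(p.1, -p.2), (μC p.1, -p.2)]

/-- The pair expansion evaluates to minus the pair combination. [folklore] -/
theorem evalL_expandPairs (ps : List (Lab × ℤ)) : evalL (expandPairs ps) = -(ps.map fun p => p.2 • mpair p.1).sum := by
  induction ps with
  | nil => simp [expandPairs]
  | cons p ps ih =>
    rw [expandPairs, List.flatMap_cons, evalL_append, ← expandPairs, ih, List.map_cons, List.sum_cons, neg_add, mpair]
    simp only [evalL_cons, evalL_nil, add_zero, smul_add, Finsupp.smul_single, smul_eq_mul, mul_one, Finsupp.single_neg]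
    abel

/-- **A certificate**: translated entries `(source, word, coefficient)` and pair entries `(label, coefficient)`. [folklore] -/
abbrev Cert : Type := List (Src × Fin 16 × ℤ) × List (Lab × ℤ)

/-- The full signed label list of a target against a certificate: target `−` entries `−` pairs. [folklore] -/
def certList (τ : ZMod 2) (tgt : Src) (C : Cert) : List (Lab × ℤ) :=
  expandSrc τ tgt 0 1 ++ (C.1.flatMap fun e => expandSrc τ e.1 e.2.1 (-e.2.2)) ++ expandPairs C.2

/-- **THE MODEL IDENTITY OF A CERTIFICATE**: if the coded list cancels, the target face sum equals the certified combination of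
translated sources and pairs. [folklore] -/
theorem sum_map_neg' {α : Type*} (l : List α) (f : α → (Lab →₀ ℤ)) : (l.map fun a => -f a).sum = -(l.map f).sum := by
  induction l with
  | nil => simp
  | cons a l ih => rw [List.map_cons, List.sum_cons, ih, List.map_cons, List.sum_cons, neg_add]

/-- **THE MODEL IDENTITY OF A CERTIFICATE**: if the coded list cancels, the target face sum equals the certified combination of
translated sources and pairs. [folklore] -/
theorem srcVal_eq_of_cancels (τ : ZMod 2) (tgt : Src) (C : Cert)
    (h : cancels ((certList τ tgt C).map fun p => (code p.1, p.2)) = true) :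
    srcVal tgt = (C.1.map fun e => e.2.2 • Finsupp.mapDomain (Motw τ e.2.1) (srcVal e.1)).sum + (C.2.map fun p => p.2 • mpair p.1).sum := by
  have h0 := evalL_eq_zero_of_cancels _ h
  rw [certList, evalL_append, evalL_append, evalL_expandSrc_zero, evalL_expandPairs, evalL_flatMap] at h0
  have h1 : (C.1.map fun e => evalL (expandSrc τ e.1 e.2.1 (-e.2.2))).sum =
      -(C.1.map fun e => e.2.2 • Finsupp.mapDomain (Motw τ e.2.1) (srcVal e.1)).sum := by
    rw [← sum_map_neg']
    congr 1
    refine List.map_congr_left fun e _ => ?_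
    rw [evalL_expandSrc, neg_smul]
  rw [h1] at h0
  rw [← sub_eq_zero, ← h0]
  abel

end

end Summit.HodgeConjecture.CorCM.Census.QuaternionDoubling
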